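import Literature.Probability.Percolation.SlabRSWGluingGeometry
import Literature.Probability.Percolation.BondStoppingSetDecoupling
import Literature.Probability.Percolation.SharpnessDCTProofs
import HarnessLib

/-!
# Newman–Tassion–Wu 2017, §3.5 — the exploration step of Theorem 3.14, Case 3 ((3.47)–(3.49))

Topic: `Literature/Probability/Percolation`. In Case 3 of the proof of NTW's RSW Theorem 3.14
(arXiv:1512.09107, p. 17) the set `𝒞` "of vertices that are either connected to `X` inside `R` or
connected to a point `z` whose distance from `Γ̄` satisfies `dist*(z, Γ̄) ≤ 3r`" is explored
(`Γ = Γ_min^S(X, 𝖫(S))`); on `𝒜 ∩ 𝓑₁ᶜ ∩ 𝓑₂ᶜ` the open path from `Y` to `𝖡(R)` lies in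
`R ∖ 𝒞`, and "if `C` is an admissible value for `𝒞`, the event `𝒞 = C` is measurable with
respect to the status of the edges adjacent to the set `C`. In particular, the status of the edges
in `R ∖ C` is independent of the event `𝒞 = C`", whence (3.49):
`P[𝒜 ∩ 𝓑₁ᶜ ∩ 𝓑₂ᶜ] ≤ Σ_{(C,γ)} P[Y ⟷^{R∖C} 𝖡(R)] · P[𝒞 = C, Γ = γ]`.

This file proves that step for an arbitrary gluing datum `Q = (S ⊆ R, A, B, C)` of the tree
(`NTW17.GlueData`, with `Γ = Q.γ` the tree's minimal path from `Ā` to `B̄` inside `S̄`) and radius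
`ρ`, in the stopping-set language of the tree (`IsStoppingSet`, `bond_real_mem_dataEvent_le`):

* `GlueData.explored Q k ρ ω` — NTW's `𝒞`: the vertices of `R̄` joined inside `R̄` to a cell of
  `A` or to a vertex within sup-distance `ρ` of `Γ̄`;
* `GlueData.explored_eq_of_agree` — configurations agreeing on the pairs of `R̄` with an endpoint
  in `𝒞(ω)` have the same `Γ` and the same `𝒞` ("`𝒞 = C` is measurable with respect to the
  edges adjacent to `C`"); `GlueData.isStoppingSet_exploredPairs` — these pairs form a stopping set;
* `GlueData.evOff Q k Z K` — the event `C ⟷^{R ∖ K} Z` (an open path from `C̄` to `Z̄` inside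
  `R̄ ∖ K`);
* **`GlueData.real_le_of_exploration`** — if `G ⊆ {C ⟷^R Z} ∩ {C ⟷^R A}ᶜ ∩ {C̄ ⟷^R̄ 𝒩(Γ̄,ρ)}ᶜ`
  and `P[C ⟷^{R ∖ 𝒞(ω)} Z] ≤ M` for every lattice configuration `ω ∈ G`, then `P[G] ≤ M`;
* **`GlueData.real_case3_le`** — the same for NTW's event
  `{A ⟷^S B} ∩ {Z ⟷^R C} ∩ {C ⟷^R A}ᶜ ∩ ({A ⟷^S B} ∩ {C̄ ⟷^R̄ 𝒩(Γ̄,ρ)})ᶜ`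
  (= `𝒜 ∩ 𝓑₁ᶜ ∩ 𝓑₂ᶜ` of Theorem 3.14 read in the reflected coordinates of
  `SlabRSWTheorem314Case2.lean`, up to the second factor of `𝒜`).

## Sources

* C. M. Newman, V. Tassion, W. Wu, *Critical percolation and the minimal spanning tree in slabs*,
  Comm. Pure Appl. Math. 70 (2017), arXiv:1512.09107: §3.5, proof of Theorem 3.14, Case 3, the
  set `𝒞`, the two observations and (3.47)–(3.49) [NewmanTassionWu2017].
* P. Nolin, Near-critical percolation in two dimensions, EJP 13 (2008), §4.4 (conditioning on
  explored data) [Nolin2008] — the tree's `bond_real_mem_dataEvent_le`.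
-/

noncomputable section

namespace Literature.Probability.Percolation

open MeasureTheory LatticeModels SimpleGraph

namespace NTW17

variable {k : ℕ}

namespace GlueData

/-! ## The explored set `𝒞` -/

section Explored

variable (Q : GlueData) (k) (ρ : ℕ)

/-- **The seeds of the exploration**: a vertex is a seed of `ω` if its column is a cell of `A` or is
within sup-distance `ρ` of the columns of `Γ(ω)`.
[cite: NewmanTassionWu2017, §3.5 (proof of Theorem 3.14, Case 3, definition of 𝒞)] -/
def IsSeed (ω : BondConfig (slab 3 k)) (s : slab 3 k) : Prop :=
  planar k s ∈ Q.A ∨ Near k (Q.γ k ω) ρ (planar k s)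

/-- **NTW's explored set `𝒞(ω)`**: the vertices of `R̄` joined inside `R̄` to a seed ("the set of
vertices that are either connected to `X` inside `R` or connected to a point `z` … with
`dist*(z, Γ̄) ≤ 3r`"). [cite: NewmanTassionWu2017, §3.5 (proof of Theorem 3.14, Case 3, the set 𝒞)] -/
def explored (ω : BondConfig (slab 3 k)) : Set (slab 3 k) :=
  {v | ∃ s, Q.IsSeed k ρ ω s ∧ ω ∈ openConnIn (slabLift k Q.R) s v}

/-- The finite set `R̄`. [cite: NewmanTassionWu2017, §3.5 (proof of Theorem 3.14, R)] -/
def Rfin : Finset (slab 3 k) := (slabLift_finite k Q.hRfin).toFinset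

open Classical in
/-- **The explored pairs**: the pairs of `R̄` with an endpoint in `𝒞(ω)` ("the edges adjacent to
the set `C`"). [cite: NewmanTassionWu2017, §3.5 (proof of Theorem 3.14, Case 3, second observation)] -/
def exploredPairs (ω : BondConfig (slab 3 k)) : Finset (Sym2 (slab 3 k)) :=
  (Q.Rfin k).sym2.filter fun e => ∃ a ∈ e, a ∈ Q.explored k ρ ω

/-- **The event `C ⟷^{R ∖ K} Z`**: an open path from `C̄` to `Z̄` all of whose vertices lie in
`R̄ ∖ K` (NTW's `Y ⟷^{R∖C} 𝖡(R)`). [cite: NewmanTassionWu2017, §3.5 (proof of Theorem 3.14, Case 3, first observation)] -/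
def evOff (Z : Set (ℤ × ℤ)) (K : Set (slab 3 k)) : Set (BondConfig (slab 3 k)) :=
  {ω | ∃ c ∈ slabLift k Q.C, ∃ z ∈ slabLift k Z, ω ∈ openConnIn (slabLift k Q.R \ K) c z}

variable {Q k ρ}

/-- Membership in `R̄` as a finite set. [cite: NewmanTassionWu2017, §3.5 (proof of Theorem 3.14)] -/
theorem mem_Rfin_iff {v : slab 3 k} : v ∈ Q.Rfin k ↔ v ∈ slabLift k Q.R := by
  rw [Rfin, Set.Finite.mem_toFinset]

/-- Membership in the explored pairs. [cite: NewmanTassionWu2017, §3.5 (proof of Theorem 3.14, Case 3)] -/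
theorem mem_exploredPairs_iff {ω : BondConfig (slab 3 k)} {e : Sym2 (slab 3 k)} :
    e ∈ Q.exploredPairs k ρ ω ↔ (∀ a ∈ e, a ∈ slabLift k Q.R) ∧ ∃ a ∈ e, a ∈ Q.explored k ρ ω := by
  classical
  rw [exploredPairs, Finset.mem_filter, Finset.mem_sym2_iff]
  simp only [mem_Rfin_iff]

/-- `𝒞(ω) ⊆ R̄`. [cite: NewmanTassionWu2017, §3.5 (proof of Theorem 3.14, Case 3)] -/
theorem explored_subset_R {ω : BondConfig (slab 3 k)} : Q.explored k ρ ω ⊆ slabLift k Q.R := by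
  rintro v ⟨s, -, -, hv, -⟩
  exact hv

/-- A seed lying in `R̄` is explored. [cite: NewmanTassionWu2017, §3.5 (proof of Theorem 3.14, Case 3)] -/
theorem mem_explored_of_isSeed {ω : BondConfig (slab 3 k)} {s : slab 3 k} (hs : Q.IsSeed k ρ ω s)
    (hsR : s ∈ slabLift k Q.R) : s ∈ Q.explored k ρ ω :=
  ⟨s, hs, DCT16.mem_openConnIn_of_pathIn (PathIn.refl hsR)⟩

/-- `𝒞(ω)` is closed under `ω`-open pairs of `R̄`. [cite: NewmanTassionWu2017, §3.5 (proof of Theorem 3.14, Case 3)] -/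
theorem mem_explored_of_mem {ω : BondConfig (slab 3 k)} {v w : slab 3 k} (hv : v ∈ Q.explored k ρ ω)
    (hw : w ∈ slabLift k Q.R) (he : s(v, w) ∈ ω) (hne : v ≠ w) : w ∈ Q.explored k ρ ω := by
  obtain ⟨s, hs, hsv⟩ := hv
  refine ⟨s, hs, DCT16.mem_openConnIn_of_pathIn ?_⟩
  exact (DCT16.pathIn_of_mem_openConnIn hsv).tail ((openGraph_adj ω v w).2 ⟨he, hne⟩) hw

/-- A pair of `R̄` with an explored endpoint is an explored pair. [cite: NewmanTassionWu2017, §3.5 (proof of Theorem 3.14, Case 3)] -/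
theorem mk_mem_exploredPairs {ω : BondConfig (slab 3 k)} {a b : slab 3 k} (ha : a ∈ Q.explored k ρ ω)
    (hb : b ∈ slabLift k Q.R) : s(a, b) ∈ Q.exploredPairs k ρ ω := by
  rw [mem_exploredPairs_iff]
  refine ⟨fun x hx => ?_, a, Sym2.mem_mk_left a b, ha⟩
  rcases Sym2.mem_iff.1 hx with rfl | rfl
  · exact explored_subset_R ha
  · exact hb

/-! ## `𝒞 = C` is determined by the pairs adjacent to `C` -/

variable {ω ω' ω₁ : BondConfig (slab 3 k)}

/-- Propagation of agreement along relational paths: if `ω'` agrees with `ω` on the pairs of `R̄`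
with an endpoint in `𝒞(ω)`, and every such pair open in `ω₁` is open in `ω` (`ω₁ = ω` or
`ω₁ = ω'`), then an `ω₁`-open path inside `R̄` from an explored vertex stays in `𝒞(ω)` and is open
in both `ω` and `ω'`. [cite: NewmanTassionWu2017, §3.5 (proof of Theorem 3.14, Case 3, second observation)] -/
theorem pathIn_transfer
    (hag : ∀ a ∈ Q.explored k ρ ω, ∀ b ∈ slabLift k Q.R, (s(a, b) ∈ ω ↔ s(a, b) ∈ ω'))
    (h₁ : ∀ a ∈ Q.explored k ρ ω, ∀ b ∈ slabLift k Q.R, s(a, b) ∈ ω₁ → s(a, b) ∈ ω)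
    {s v : slab 3 k} (hs : s ∈ Q.explored k ρ ω) (hp : PathIn (openGraph ω₁) (slabLift k Q.R) s v) :
    v ∈ Q.explored k ρ ω ∧ PathIn (openGraph ω) (slabLift k Q.R) s v ∧
      PathIn (openGraph ω') (slabLift k Q.R) s v := by
  obtain ⟨hsR, hr⟩ := hp
  induction hr with
  | refl => exact ⟨hs, PathIn.refl hsR, PathIn.refl hsR⟩
  | @tail b c _ hbc ih =>
    obtain ⟨hb, hpb, hpb'⟩ := ih
    have hadj : s(b, c) ∈ ω₁ ∧ b ≠ c := (openGraph_adj ω₁ b c).1 hbc.1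
    have hω : s(b, c) ∈ ω := h₁ b hb c hbc.2 hadj.1
    have hω' : s(b, c) ∈ ω' := (hag b hb c hbc.2).1 hω
    exact ⟨mem_explored_of_mem hb hbc.2 hω hadj.2,
      hpb.tail ((openGraph_adj ω b c).2 ⟨hω, hadj.2⟩) hbc.2,
      hpb'.tail ((openGraph_adj ω' b c).2 ⟨hω', hadj.2⟩) hbc.2⟩

/-- Propagation of agreement along chains (lists): an `ω₁`-open chain of vertices of `R̄` whose
first vertex is explored stays in `𝒞(ω)` and is open in both `ω` and `ω'`.
[cite: NewmanTassionWu2017, §3.5 (proof of Theorem 3.14, Case 3, second observation)] -/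
theorem chain_transfer
    (hag : ∀ a ∈ Q.explored k ρ ω, ∀ b ∈ slabLift k Q.R, (s(a, b) ∈ ω ↔ s(a, b) ∈ ω'))
    (h₁ : ∀ a ∈ Q.explored k ρ ω, ∀ b ∈ slabLift k Q.R, s(a, b) ∈ ω₁ → s(a, b) ∈ ω) :
    ∀ (a : slab 3 k) (l : List (slab 3 k)), a ∈ Q.explored k ρ ω → (∀ x ∈ l, x ∈ slabLift k Q.R) →
      (a :: l).IsChain (fun x y => s(x, y) ∈ ω₁ ∧ x ≠ y) →
      (∀ x ∈ a :: l, x ∈ Q.explored k ρ ω) ∧ (a :: l).IsChain (fun x y => s(x, y) ∈ ω ∧ x ≠ y) ∧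
        (a :: l).IsChain (fun x y => s(x, y) ∈ ω' ∧ x ≠ y) := by
  intro a l
  induction l generalizing a with
  | nil =>
    intro ha _ _
    exact ⟨fun x hx => by rw [List.mem_singleton] at hx; rw [hx]; exact ha, List.IsChain.singleton _,
      List.IsChain.singleton _⟩
  | cons b l ih =>
    intro ha hR hc
    rw [List.isChain_cons_cons] at hc
    have hbR : b ∈ slabLift k Q.R := hR b (by simp)
    have hω : s(a, b) ∈ ω := h₁ a ha b hbR hc.1.1
    have hω' : s(a, b) ∈ ω' := (hag a ha b hbR).1 hω
    have hb : b ∈ Q.explored k ρ ω := mem_explored_of_mem ha hbR hω hc.1.2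
    obtain ⟨hmem, hcω, hcω'⟩ := ih b hb (fun x hx => hR x (List.mem_cons_of_mem _ hx)) hc.2
    refine ⟨fun x hx => ?_, List.IsChain.cons_cons ⟨hω, hc.1.2⟩ hcω,
      List.IsChain.cons_cons ⟨hω', hc.1.2⟩ hcω'⟩
    rcases List.mem_cons.1 hx with rfl | hx
    · exact ha
    · exact hmem x hx

/-- Under the agreement hypothesis, `ω` and `ω'` have the same open self-avoiding paths from `Ā`
inside `S̄` (to any target). [cite: NewmanTassionWu2017, §3.5 (proof of Theorem 3.14, Case 3, "Γ is already determined after this first exploration")] -/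
theorem isOSAP_iff_of_agree
    (hag : ∀ a ∈ Q.explored k ρ ω, ∀ b ∈ slabLift k Q.R, (s(a, b) ∈ ω ↔ s(a, b) ∈ ω'))
    (Y : Set (slab 3 k)) (l : List (slab 3 k)) :
    IsOSAP k ω (slabLift k Q.S) (slabLift k Q.A) Y l ↔ IsOSAP k ω' (slabLift k Q.S) (slabLift k Q.A) Y l := by
  -- the first vertex of such a path is a seed in `R̄`, hence explored
  have head_expl : ∀ {ω₂ : BondConfig (slab 3 k)}, IsOSAP k ω₂ (slabLift k Q.S) (slabLift k Q.A) Y l →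
      ∀ a l', l = a :: l' → a ∈ Q.explored k ρ ω ∧ ∀ x ∈ l', x ∈ slabLift k Q.R := by
    intro ω₂ hl a l' hal
    subst hal
    have haA : a ∈ slabLift k Q.A := by simpa using hl.head_mem hl.ne_nil
    have hR : ∀ x ∈ a :: l', x ∈ slabLift k Q.R := fun x hx => slabLift_mono k Q.hSR (hl.subset x hx)
    exact ⟨mem_explored_of_isSeed (Or.inl haA) (hR a (by simp)), fun x hx => hR x (List.mem_cons_of_mem _ hx)⟩
  constructor
  · intro hl
    obtain ⟨a, l', hal⟩ := List.exists_cons_of_ne_nil hl.ne_nil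
    obtain ⟨ha, hR⟩ := head_expl hl a l' hal
    have hc := hl.chain
    rw [hal] at hc
    obtain ⟨-, -, hc'⟩ := chain_transfer hag (fun _ _ _ _ h => h) a l' ha hR hc
    rw [← hal] at hc'
    exact ⟨hl.nodup, hc', hl.subset, hl.ne_nil, hl.head_mem, hl.last_mem⟩
  · intro hl
    obtain ⟨a, l', hal⟩ := List.exists_cons_of_ne_nil hl.ne_nil
    obtain ⟨ha, hR⟩ := head_expl hl a l' hal
    have hc := hl.chain
    rw [hal] at hc
    obtain ⟨-, hc', -⟩ := chain_transfer hag (fun a ha b hb h => (hag a ha b hb).2 h) a l' ha hR hc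
    rw [← hal] at hc'
    exact ⟨hl.nodup, hc', hl.subset, hl.ne_nil, hl.head_mem, hl.last_mem⟩

/-- Configurations with the same open self-avoiding paths have the same minimal path.
[cite: NewmanTassionWu2017, §3.2 (definition of Γ_min)] -/
theorem minPath_congr_of_iff {S X Y : Set (slab 3 k)} (hS : S.Finite)
    (h : ∀ l, IsOSAP k ω S X Y l ↔ IsOSAP k ω' S X Y l) : minPath k ω S X Y = minPath k ω' S X Y := by
  by_cases hex : ∃ l, IsOSAP k ω S X Y l
  · obtain ⟨h1, h2⟩ := minPath_spec hS hex
    symm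
    exact minPath_eq_of_min hS ((h _).1 h1) fun l' hl' => h2 l' ((h _).2 hl')
  · rw [minPath_eq_nil hex, minPath_eq_nil]
    rintro ⟨l, hl⟩
    exact hex ⟨l, (h _).2 hl⟩

/-- **`Γ` is determined by the explored pairs.** [cite: NewmanTassionWu2017, §3.5 (proof of Theorem 3.14, Case 3, "the minimal path Γ is already determined after this first exploration")] -/
theorem γ_eq_of_agree
    (hag : ∀ a ∈ Q.explored k ρ ω, ∀ b ∈ slabLift k Q.R, (s(a, b) ∈ ω ↔ s(a, b) ∈ ω')) :
    Q.γ k ω' = Q.γ k ω :=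
  (minPath_congr_of_iff Q.S_finite (isOSAP_iff_of_agree hag (slabLift k Q.B))).symm

/-- Under the agreement hypothesis the seeds agree. [cite: NewmanTassionWu2017, §3.5 (proof of Theorem 3.14, Case 3)] -/
theorem isSeed_iff_of_agree
    (hag : ∀ a ∈ Q.explored k ρ ω, ∀ b ∈ slabLift k Q.R, (s(a, b) ∈ ω ↔ s(a, b) ∈ ω'))
    (s : slab 3 k) : Q.IsSeed k ρ ω' s ↔ Q.IsSeed k ρ ω s := by
  rw [IsSeed, IsSeed, γ_eq_of_agree hag]

/-- **"`𝒞 = C` is measurable with respect to the status of the edges adjacent to `C`"**: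
configurations agreeing on the pairs of `R̄` with an endpoint in `𝒞(ω)` have the same explored set.
[cite: NewmanTassionWu2017, §3.5 (proof of Theorem 3.14, Case 3, second observation)] -/
theorem explored_eq_of_agree
    (hag : ∀ a ∈ Q.explored k ρ ω, ∀ b ∈ slabLift k Q.R, (s(a, b) ∈ ω ↔ s(a, b) ∈ ω')) :
    Q.explored k ρ ω' = Q.explored k ρ ω := by
  ext v
  constructor
  · rintro ⟨s, hs, hsv⟩
    have hs' : Q.IsSeed k ρ ω s := (isSeed_iff_of_agree hag s).1 hs
    have hsR : s ∈ slabLift k Q.R := (DCT16.pathIn_of_mem_openConnIn hsv).left_mem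
    exact (pathIn_transfer hag (fun a ha b hb h => (hag a ha b hb).2 h) (mem_explored_of_isSeed hs' hsR)
      (DCT16.pathIn_of_mem_openConnIn hsv)).1
  · rintro ⟨s, hs, hsv⟩
    have hsR : s ∈ slabLift k Q.R := (DCT16.pathIn_of_mem_openConnIn hsv).left_mem
    refine ⟨s, (isSeed_iff_of_agree hag s).2 hs, DCT16.mem_openConnIn_of_pathIn ?_⟩
    exact (pathIn_transfer hag (fun _ _ _ _ h => h) (mem_explored_of_isSeed hs hsR)
      (DCT16.pathIn_of_mem_openConnIn hsv)).2.2

/-- Agreement on the explored pairs gives the agreement hypothesis.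
[cite: NewmanTassionWu2017, §3.5 (proof of Theorem 3.14, Case 3)] -/
theorem agree_of_exploredPairs (h : ∀ e ∈ Q.exploredPairs k ρ ω, e ∈ ω ↔ e ∈ ω') :
    ∀ a ∈ Q.explored k ρ ω, ∀ b ∈ slabLift k Q.R, (s(a, b) ∈ ω ↔ s(a, b) ∈ ω') :=
  fun _ ha _ hb => h _ (mk_mem_exploredPairs ha hb)

/-- **The explored pairs form a stopping set.** [cite: NewmanTassionWu2017, §3.5 (proof of Theorem 3.14, Case 3, second observation)] -/
theorem isStoppingSet_exploredPairs : IsStoppingSet (Q.exploredPairs k ρ) := by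
  intro ω ω' h
  have hE := explored_eq_of_agree (agree_of_exploredPairs h)
  ext e
  rw [mem_exploredPairs_iff, mem_exploredPairs_iff, hE]

/-- The explored pairs are pairs of `R̄`. [cite: NewmanTassionWu2017, §3.5 (proof of Theorem 3.14, Case 3)] -/
theorem exploredPairs_subset (ω : BondConfig (slab 3 k)) : Q.exploredPairs k ρ ω ⊆ (Q.Rfin k).sym2 := by
  intro e he
  rw [Finset.mem_sym2_iff]
  exact fun a ha => mem_Rfin_iff.2 ((mem_exploredPairs_iff.1 he).1 a ha)

/-- Configurations with the same explored pairs and the same open explored pairs have the same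
explored set. [cite: NewmanTassionWu2017, §3.5 (proof of Theorem 3.14, Case 3)] -/
theorem explored_eq_of_data [DecidablePred (· ∈ ω)] [DecidablePred (· ∈ ω')]
    (hN : Q.exploredPairs k ρ ω = Q.exploredPairs k ρ ω')
    (hη : (Q.exploredPairs k ρ ω).filter (· ∈ ω) = (Q.exploredPairs k ρ ω').filter (· ∈ ω')) :
    Q.explored k ρ ω' = Q.explored k ρ ω := by
  refine explored_eq_of_agree (agree_of_exploredPairs fun e he => ?_)
  constructor
  · intro heω
    have : e ∈ (Q.exploredPairs k ρ ω').filter (· ∈ ω') := by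
      rw [← hη]; exact Finset.mem_filter.2 ⟨he, heω⟩
    exact (Finset.mem_filter.1 this).2
  · intro heω'
    have : e ∈ (Q.exploredPairs k ρ ω).filter (· ∈ ω) := by
      rw [hη]; exact Finset.mem_filter.2 ⟨hN ▸ he, heω'⟩
    exact (Finset.mem_filter.1 this).2

/-! ## The first observation: the path from `C` avoids `𝒞` -/

/-- **First observation of Case 3**: if `C ⟷^R Z` holds but neither `C ⟷^R A` nor
`C̄ ⟷^R̄ 𝒩(Γ̄, ρ)`, the open path from `C̄` to `Z̄` lies in `R̄ ∖ 𝒞(ω)`.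
[cite: NewmanTassionWu2017, §3.5 (proof of Theorem 3.14, Case 3, first observation)] -/
theorem mem_evOff_explored {Z : Set (ℤ × ℤ)} (hCZ : ω ∈ slabConn k Q.R Q.C Z) (hCA : ω ∉ Q.evCA k)
    (hN : ω ∉ Q.evNear k ρ) : ω ∈ Q.evOff k Z (Q.explored k ρ ω) := by
  obtain ⟨c, hc, z, hz, hcz⟩ := hCZ
  have hp := DCT16.pathIn_of_mem_openConnIn hcz
  -- every vertex joined to `c` inside `R̄` is unexplored
  have key : ∀ v, PathIn (openGraph ω) (slabLift k Q.R) c v → v ∉ Q.explored k ρ ω := by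
    rintro v hv ⟨s, hs, hsv⟩
    have hcs : ω ∈ openConnIn (slabLift k Q.R) c s :=
      DCT16.mem_openConnIn_of_pathIn (hv.trans (DCT16.pathIn_of_mem_openConnIn hsv).symm)
    rcases hs with hsA | hsN
    · exact hCA ⟨c, hc, s, hsA, hcs⟩
    · exact hN ⟨c, hc, s, hcs, hsN⟩
  refine ⟨c, hc, z, hz, DCT16.mem_openConnIn_of_pathIn ?_⟩
  -- restrict the path to `R̄ ∖ 𝒞`
  obtain ⟨hcR, hr⟩ := hp
  have hc0 : c ∈ slabLift k Q.R \ Q.explored k ρ ω := ⟨hcR, key c (PathIn.refl hcR)⟩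
  suffices H : ∀ v, Relation.ReflTransGen (fun a b => (openGraph ω).Adj a b ∧ b ∈ slabLift k Q.R) c v →
      PathIn (openGraph ω) (slabLift k Q.R \ Q.explored k ρ ω) c v from H z hr
  intro v hv
  induction hv with
  | refl => exact PathIn.refl hc0
  | @tail b d hb hbd ih =>
    exact ih.tail hbd.1 ⟨hbd.2, key d (PathIn.tail ⟨hcR, hb⟩ hbd.1 hbd.2)⟩

/-! ## The decoupling inequality -/

/-- `C ⟷^{R ∖ K} Z` is determined by the pairs of `R̄` with no endpoint in `K`.
[cite: NewmanTassionWu2017, §3.5 (proof of Theorem 3.14, Case 3, "the status of the edges in R ∖ C is independent of the event 𝒞 = C")] -/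
theorem determinedBy_evOff (Z : Set (ℤ × ℤ)) (K : Set (slab 3 k)) {H : Set (Sym2 (slab 3 k))}
    (hH : (slabLift k Q.R \ K).sym2 ⊆ H) : DeterminedBy (Q.evOff k Z K) H := by
  rw [determinedBy_iff]
  intro ω ω' h
  simp only [evOff, Set.mem_setOf_eq]
  have key : ∀ c z, ω ∈ openConnIn (slabLift k Q.R \ K) c z ↔ ω' ∈ openConnIn (slabLift k Q.R \ K) c z :=
    fun c z => (determinedBy_iff _ _).1 (DCT16.determinedBy_openConnIn _ c z hH) ω ω' h
  simp only [key]

open Classical in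
/-- **NTW 2017, Theorem 3.14, Case 3, the exploration inequality (3.47)–(3.49), abstract form.**
Let `G ⊆ {C ⟷^R Z} ∩ {C ⟷^R A}ᶜ ∩ {C̄ ⟷^R̄ 𝒩(Γ̄, ρ)}ᶜ`, and suppose `P_p[C ⟷^{R ∖ 𝒞(ω)} Z] ≤ M`
for every lattice configuration `ω ∈ G` (every admissible value of `𝒞`). Then `P_p[G] ≤ M`:
"summing over the admissible realizations … `P[𝒜 ∩ 𝓑₁ᶜ ∩ 𝓑₂ᶜ] ≤ Σ P[Y ⟷^{R∖C} 𝖡(R)] P[𝒞 = C, Γ = γ]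
≤ max_γ P[𝒞_γ]`". [cite: NewmanTassionWu2017, §3.5 (proof of Theorem 3.14, Case 3, (3.47)–(3.49))] -/
theorem real_le_of_exploration (p : unitInterval) (Z : Set (ℤ × ℤ)) {G : Set (BondConfig (slab 3 k))}
    (hG : G ⊆ slabConn k Q.R Q.C Z ∩ (Q.evCA k)ᶜ ∩ (Q.evNear k ρ)ᶜ) {M : ℝ} (hM : 0 ≤ M)
    (hbound : ∀ ω ∈ G, ω ⊆ (slabGraph 3 k).edgeSet →
      (bondPercolation (slabGraph 3 k) p).real (Q.evOff k Z (Q.explored k ρ ω)) ≤ M) :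
    (bondPercolation (slabGraph 3 k) p).real G ≤ M := by
  set P := bondPercolation (slabGraph 3 k) p with hP
  set N := Q.exploredPairs k ρ with hNdef
  -- admissible data and the data event
  let Adm : Finset (Sym2 (slab 3 k)) → Finset (Sym2 (slab 3 k)) → Prop := fun F η =>
    ∃ ω₀ : BondConfig (slab 3 k), ω₀ ∈ G ∧ ω₀ ⊆ (slabGraph 3 k).edgeSet ∧ N ω₀ = F ∧ (N ω₀).filter (· ∈ ω₀) = η
  let Aev : Finset (Sym2 (slab 3 k)) → Finset (Sym2 (slab 3 k)) → Set (BondConfig (slab 3 k)) := fun F η =>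
    if h : Adm F η then Q.evOff k Z (Q.explored k ρ (Classical.choose h)) else ∅
  have hNst : IsStoppingSet N := isStoppingSet_exploredPairs
  have hNG : ∀ ω, N ω ⊆ (Q.Rfin k).sym2 := exploredPairs_subset
  have hA : ∀ F η, ∃ H : Finset (Sym2 (slab 3 k)), Disjoint F H ∧ DeterminedBy (Aev F η) ↑H := by
    intro F η
    by_cases h : Adm F η
    · set ω₀ := Classical.choose h with hω₀
      have hω₀spec : ω₀ ∈ G ∧ ω₀ ⊆ (slabGraph 3 k).edgeSet ∧ N ω₀ = F ∧ (N ω₀).filter (· ∈ ω₀) = η :=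
        Classical.choose_spec h
      refine ⟨(Q.Rfin k).sym2.filter (fun e => ∀ a ∈ e, a ∉ Q.explored k ρ ω₀), ?_, ?_⟩
      · rw [← hω₀spec.2.2.1, Finset.disjoint_left]
        intro e he he'
        obtain ⟨-, a, hae, ha⟩ := mem_exploredPairs_iff.1 he
        exact (Finset.mem_filter.1 he').2 a hae ha
      · have hAev : Aev F η = Q.evOff k Z (Q.explored k ρ ω₀) := by
          simp only [Aev, dif_pos h, hω₀]
        rw [hAev]
        refine determinedBy_evOff Z _ fun e he => ?_
        rw [Finset.coe_filter, Set.mem_setOf_eq, Finset.mem_sym2_iff]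
        induction e using Sym2.ind with
        | h a b =>
          rw [Set.mk_mem_sym2_iff] at he
          refine ⟨fun x hx => ?_, fun x hx => ?_⟩
          · rcases Sym2.mem_iff.1 hx with rfl | rfl
            · exact mem_Rfin_iff.2 he.1.1
            · exact mem_Rfin_iff.2 he.2.1
          · rcases Sym2.mem_iff.1 hx with rfl | rfl
            · exact he.1.2
            · exact he.2.2
    · refine ⟨∅, Finset.disjoint_empty_right _, ?_⟩
      have hAev : Aev F η = ∅ := by simp only [Aev, dif_neg h]
      rw [hAev, determinedBy_iff]
      intro _ _ _
      simp
  have hAε : ∀ F η, P.real (Aev F η) ≤ M := by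
    intro F η
    by_cases h : Adm F η
    · have hAev : Aev F η = Q.evOff k Z (Q.explored k ρ (Classical.choose h)) := by
        simp only [Aev, dif_pos h]
      rw [hAev]
      have hs := Classical.choose_spec h
      exact hbound _ hs.1 hs.2.1
    · have hAev : Aev F η = ∅ := by simp only [Aev, dif_neg h]
      rw [hAev, measureReal_empty]
      exact hM
  have hmain := bond_real_mem_dataEvent_le (slabGraph 3 k) p hNst hNG Aev hA hM hAε
  -- `G` is contained in the data event up to a null set
  have hae : ∀ᵐ ω ∂P, ω ∈ G → ω ∈ {ω | ω ∈ Aev (N ω) ((N ω).filter (· ∈ ω))} := by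
    filter_upwards [ae_subset_edgeSet (slabGraph 3 k) p] with ω hω hωG
    have hadm : Adm (N ω) ((N ω).filter (· ∈ ω)) := ⟨ω, hωG, hω, rfl, rfl⟩
    show ω ∈ Aev (N ω) ((N ω).filter (· ∈ ω))
    have hAev : Aev (N ω) ((N ω).filter (· ∈ ω)) =
        Q.evOff k Z (Q.explored k ρ (Classical.choose hadm)) := by
      simp only [Aev, dif_pos hadm]
    rw [hAev]
    obtain ⟨-, -, hNeq, hηeq⟩ := Classical.choose_spec hadm
    have hE : Q.explored k ρ (Classical.choose hadm) = Q.explored k ρ ω :=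
      explored_eq_of_data hNeq.symm hηeq.symm
    rw [hE]
    obtain ⟨⟨hCZ, hCA⟩, hNn⟩ := hG hωG
    exact mem_evOff_explored hCZ hCA hNn
  have hmono : P.real G ≤ P.real {ω | ω ∈ Aev (N ω) ((N ω).filter (· ∈ ω))} := by
    simp only [measureReal_def]
    exact ENNReal.toReal_mono (measure_ne_top _ _) (measure_mono_ae hae)
  exact hmono.trans hmain

/-- **NTW 2017, Theorem 3.14, Case 3 — the exploration inequality for
`𝒜' ∩ 𝓑₁ᶜ ∩ 𝓑₂ᶜ = {A ⟷^S B} ∩ {Z ⟷^R C} ∩ {C ⟷^R A}ᶜ ∩ ({A ⟷^S B} ∩ {C̄ ⟷^R̄ 𝒩(Γ̄, ρ)})ᶜ`**: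
if `P_p[C ⟷^{R ∖ 𝒞(ω)} Z] ≤ M` for every lattice configuration `ω` of this event, then its
probability is at most `M`. [cite: NewmanTassionWu2017, §3.5 (proof of Theorem 3.14, Case 3, (3.49))] -/
theorem real_case3_le (p : unitInterval) (Z : Set (ℤ × ℤ)) {M : ℝ} (hM : 0 ≤ M)
    (hbound : ∀ ω : BondConfig (slab 3 k), ω ⊆ (slabGraph 3 k).edgeSet → ω ∈ Q.evAB k →
      ω ∈ slabConn k Q.R Z Q.C → ω ∉ Q.evCA k → ω ∉ Q.evNear k ρ →
      (bondPercolation (slabGraph 3 k) p).real (Q.evOff k Z (Q.explored k ρ ω)) ≤ M) :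
    (bondPercolation (slabGraph 3 k) p).real
      (Q.evAB k ∩ slabConn k Q.R Z Q.C ∩ (Q.evCA k)ᶜ ∩ (Q.evAB k ∩ Q.evNear k ρ)ᶜ) ≤ M := by
  refine real_le_of_exploration (Q := Q) (ρ := ρ) p Z (fun ω hω => ?_) hM fun ω hω hωE => ?_
  · obtain ⟨⟨⟨hAB, hZC⟩, hCA⟩, hN⟩ := hω
    exact ⟨⟨slabConn_comm hZC, hCA⟩, fun h => hN ⟨hAB, h⟩⟩
  · obtain ⟨⟨⟨hAB, hZC⟩, hCA⟩, hN⟩ := hω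
    exact hbound ω hωE hAB hZC hCA fun h => hN ⟨hAB, h⟩

end Explored

end GlueData

end NTW17

end Literature.Probability.Percolation
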